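import Summits.CriticalPhenomena.PercolationContinuityZ3.Theorems.PercNearOneGluingNoHeavyLowerTailKnQuestion8CoefficientwiseRootSetKernelRowTwoCoreNoBy
import HarnessLib

/-!
# The root-set kernel: ROW 2 of RCSET when `y` hangs off `q` (no `U–y` edge, `U ∼ q`, `q ∼ y`) — prim-lf-2 gen 60

Support file (`--supports stmt-CriticalPhenomena-4575`, closed), prover `prim-lf-2` (gen 60).  No definitions, no named facts, no sorries; standard axioms.
Memo `prim-lf-2/CW-ATOM-gen60.md` §5; companions `…RootSetKernelRowTwoCoreNoBy.lean` (the combinatorial core `rcset_row_two_core_noBy`), `…RowTwo.lean`, `…RowTwoNonAdj.lean`,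
`…RowTwoNoAq.lean` (the other cases of row 2), `…RowTwoPrep.lean` (set-cluster primitives, `sum_powerset_union_of_disjoint`).

Kernel notation: `R_A(t) = {v | ∃ a ∈ A, v ∈ C_a(t)}`, `B_A(t) = R_A(E ∖ t)`, `Φ(A,A') = Σ_{t ⊆ E : ¬(y∈R_A(t) ∧ y∈B_{A'}(t))} T(R_A(t), B_{A'}(t))`.
* `Coefficientwise.rcset_row_two_noBy` — **THEOREM: ROW 2 of RCSET when no edge joins `U = V ∖ {y,q}` to `y`**, while `U ∼ q` and `q ∼ y`:  `Φ(U,U) ≤ 2·Φ(S,U)`.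
Proof.  Split `t = τ ∪ ω` (`ω ⊆ Out = Aq ∪ Cq`, the `U–q` and `q–y` edges), fix `τ`; the maps `ω ↦ R_S(τ∪ω), R_U(τ∪ω), B_U(τ∪ω)` satisfy the axioms of `rcset_row_two_core_noBy`
(with no `U–y` edge, `y` is reached exactly through `q` and a `q–y` edge).
[cite: KozmaNitzan2024, Questions 8–9 (§5.5 p. 36) (context: the Question-8 pocket covariance programme)]
-/

namespace Summit.CriticalPhenomena.PercolationContinuityZ3.Theorems

open Finset Literature.Probability.Percolation

namespace Coefficientwise

variable {ι V : Type*}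

open Classical in
/-- **Row 2 of RCSET, pendant case `b = 0`** (see the module docstring): for finite `V`, `y ≠ q`, `U = V ∖ {y, q}`, `y, q ∉ S`, monotone `f, g`, an edge `U–q` and an edge `q–y`
in `E`, and NO edge of `E` joining `y` to a vertex of `U`:  `Φ(U,U) ≤ 2·Φ(S,U)`. [cite: KozmaNitzan2024, Questions 8–9 (§5.5 p. 36) (context)] -/
theorem rcset_row_two_noBy [Fintype V] [DecidableEq V] (ends : ι → Sym2 V) (E : Finset ι) (y q : V) (hyq : y ≠ q) (S : Finset V) (hyS : y ∉ S) (hqS : q ∉ S)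
    (hAq : ∃ i ∈ E, ∃ u : V, u ≠ q ∧ u ≠ y ∧ ends i = s(u, q)) (hCq : ∃ i ∈ E, ends i = s(q, y))
    (hnBy : ∀ i ∈ E, ∀ u : V, u ≠ q → u ≠ y → ends i ≠ s(u, y))
    (f g : Set V → ℝ) (hf : Monotone f) (hg : Monotone g) :
    (∑ s ∈ E.powerset.filter (fun s : Finset ι =>
          ¬ ((∃ a ∈ ((Finset.univ : Finset V).erase y).erase q, y ∈ openCluster (ends '' (↑s : Set ι)) a) ∧
             (∃ a ∈ ((Finset.univ : Finset V).erase y).erase q, y ∈ openCluster (ends '' (↑(E \ s) : Set ι)) a))),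
        (f {v | ∃ a ∈ ((Finset.univ : Finset V).erase y).erase q, v ∈ openCluster (ends '' (↑s : Set ι)) a} -
            f {v | ∃ a ∈ ((Finset.univ : Finset V).erase y).erase q, v ∈ openCluster (ends '' (↑(E \ s) : Set ι)) a}) *
          (g {v | ∃ a ∈ ((Finset.univ : Finset V).erase y).erase q, v ∈ openCluster (ends '' (↑s : Set ι)) a} -
            g {v | ∃ a ∈ ((Finset.univ : Finset V).erase y).erase q, v ∈ openCluster (ends '' (↑(E \ s) : Set ι)) a})) ≤
    2 * ∑ s ∈ E.powerset.filter (fun s : Finset ι =>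
          ¬ ((∃ a ∈ S, y ∈ openCluster (ends '' (↑s : Set ι)) a) ∧
             (∃ a ∈ ((Finset.univ : Finset V).erase y).erase q, y ∈ openCluster (ends '' (↑(E \ s) : Set ι)) a))),
        (f {v | ∃ a ∈ S, v ∈ openCluster (ends '' (↑s : Set ι)) a} -
            f {v | ∃ a ∈ ((Finset.univ : Finset V).erase y).erase q, v ∈ openCluster (ends '' (↑(E \ s) : Set ι)) a}) *
          (g {v | ∃ a ∈ S, v ∈ openCluster (ends '' (↑s : Set ι)) a} -
            g {v | ∃ a ∈ ((Finset.univ : Finset V).erase y).erase q, v ∈ openCluster (ends '' (↑(E \ s) : Set ι)) a}) := by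
  -- notation
  set U : Finset V := ((Finset.univ : Finset V).erase y).erase q with hU
  set RU : Finset ι → Set V := fun t => {v | ∃ a ∈ U, v ∈ openCluster (ends '' (↑t : Set ι)) a} with hRU
  set RS : Finset ι → Set V := fun t => {v | ∃ a ∈ S, v ∈ openCluster (ends '' (↑t : Set ι)) a} with hRS
  set admU : Finset ι → Prop := fun s => ¬ ((∃ a ∈ U, y ∈ openCluster (ends '' (↑s : Set ι)) a) ∧
      (∃ a ∈ U, y ∈ openCluster (ends '' (↑(E \ s) : Set ι)) a)) with hadmU
  set admS : Finset ι → Prop := fun s => ¬ ((∃ a ∈ S, y ∈ openCluster (ends '' (↑s : Set ι)) a) ∧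
      (∃ a ∈ U, y ∈ openCluster (ends '' (↑(E \ s) : Set ι)) a)) with hadmS
  set TU : Finset ι → ℝ := fun s => (f (RU s) - f (RU (E \ s))) * (g (RU s) - g (RU (E \ s))) with hTU
  set TS : Finset ι → ℝ := fun s => (f (RS s) - f (RU (E \ s))) * (g (RS s) - g (RU (E \ s))) with hTS
  change ∑ s ∈ E.powerset.filter admU, TU s ≤ 2 * ∑ s ∈ E.powerset.filter admS, TS s
  /- ### vertices -/
  have hyU : y ∉ U := fun h => (Finset.mem_erase.mp (Finset.mem_erase.mp h).2).1 rfl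
  have hqU : q ∉ U := fun h => (Finset.mem_erase.mp h).1 rfl
  have memU : ∀ v : V, v ≠ q → v ≠ y → v ∈ U := fun v h1 h2 => Finset.mem_erase.mpr ⟨h1, Finset.mem_erase.mpr ⟨h2, Finset.mem_univ v⟩⟩
  have hSU : (↑S : Set V) ⊆ ↑U := by
    intro v hv
    have hv' := Finset.mem_coe.mp hv
    exact Finset.mem_coe.mpr (memU v (fun h => hqS (h ▸ hv')) (fun h => hyS (h ▸ hv')))
  have hUsubRU : ∀ t, (↑U : Set V) ⊆ RU t := fun t => subset_setCluster ends U t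
  /- ### edge classes -/
  set Aq : Finset ι := E.filter (fun i => ∃ u : V, u ≠ q ∧ u ≠ y ∧ ends i = s(u, q)) with hAqdef
  set Cq : Finset ι := E.filter (fun i => ends i = s(q, y)) with hCqdef
  set Out : Finset ι := Aq ∪ Cq with hOut
  set E' : Finset ι := E \ Out with hE'
  have hAqE : Aq ⊆ E := Finset.filter_subset _ E
  have hCqE : Cq ⊆ E := Finset.filter_subset _ E
  have hOutE : Out ⊆ E := Finset.union_subset hAqE hCqE
  have hAqOut : Aq ⊆ Out := Finset.subset_union_left
  have hCqOut : Cq ⊆ Out := Finset.subset_union_right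
  have hAqne : Aq.Nonempty := by
    obtain ⟨i, hi, u, h1, h2, h3⟩ := hAq; exact ⟨i, Finset.mem_filter.mpr ⟨hi, u, h1, h2, h3⟩⟩
  have hCqne : Cq.Nonempty := by
    obtain ⟨i, hi, h3⟩ := hCq; exact ⟨i, Finset.mem_filter.mpr ⟨hi, h3⟩⟩
  have endsAq : ∀ i ∈ Aq, ∃ u : V, u ∈ U ∧ ends i = s(u, q) := by
    intro i hi; obtain ⟨_, u, h1, h2, h3⟩ := Finset.mem_filter.mp hi; exact ⟨u, memU u h1 h2, h3⟩
  have endsCq : ∀ i ∈ Cq, ends i = s(q, y) := fun i hi => (Finset.mem_filter.mp hi).2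
  have hAqCq : ∀ i, i ∈ Aq → i ∉ Cq := by
    intro i hi hi'
    obtain ⟨u, hu, h⟩ := endsAq i hi; have h' := endsCq i hi'
    rw [h] at h'
    rcases Sym2.eq_iff.mp h' with ⟨h1, _⟩ | ⟨h1, _⟩
    · exact hqU (h1 ▸ hu)
    · exact hyU (h1 ▸ hu)
  have hdisj : Disjoint Aq Cq := Finset.disjoint_left.mpr (fun i hi => hAqCq i hi)
  -- with no `U–y` edge, every non-loop edge of `E` at `y` is a `Cq` edge; every non-loop edge at `q` is an `Aq` or a `Cq` edge
  have at_y : ∀ i ∈ E, ∀ w : V, w ≠ y → ends i = s(w, y) → i ∈ Cq := by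
    intro i hi w hwy h
    by_cases hwq : w = q
    · exact Finset.mem_filter.mpr ⟨hi, by rw [h, hwq]⟩
    · exact absurd h (hnBy i hi w hwq hwy)
  have at_q : ∀ i ∈ E, ∀ w : V, w ≠ q → ends i = s(w, q) → i ∈ Aq ∨ i ∈ Cq := by
    intro i hi w hwq h
    by_cases hwy : w = y
    · exact Or.inr (Finset.mem_filter.mpr ⟨hi, by rw [h, hwy, Sym2.eq_swap]⟩)
    · exact Or.inl (Finset.mem_filter.mpr ⟨hi, w, hwq, hwy, h⟩)
  -- closure of `U` under the non-`Aq` edges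
  have closedU : ∀ i ∈ E, i ∉ Aq → ∀ u w : V, ends i = s(u, w) → u ∈ (↑U : Set V) → w ∈ (↑U : Set V) := by
    intro i hi hiA u w h hu
    have hu' := Finset.mem_coe.mp hu
    have huq : u ≠ q := fun e => hqU (e ▸ hu')
    have huy : u ≠ y := fun e => hyU (e ▸ hu')
    by_cases hwq : w = q
    · exact absurd (Finset.mem_filter.mpr ⟨hi, u, huq, huy, by rw [h, hwq]⟩) hiA
    by_cases hwy : w = y
    · exact absurd (by rw [h, hwy]) (hnBy i hi u huq huy)
    exact Finset.mem_coe.mpr (memU w hwq hwy)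
  /- ### cluster facts for colourings `t ⊆ E` -/
  have RS_sub_U : ∀ t : Finset ι, t ⊆ E → (∀ i ∈ t, i ∉ Aq) → RS t ⊆ ↑U :=
    fun t ht hA => setCluster_subset_of_closed ends hSU (fun i hi u w h hu => closedU i (ht hi) (hA i hi) u w h hu)
  have RU_sub_U : ∀ t : Finset ι, t ⊆ E → (∀ i ∈ t, i ∉ Aq) → RU t ⊆ ↑U :=
    fun t ht hA => setCluster_subset_of_closed ends subset_rfl (fun i hi u w h hu => closedU i (ht hi) (hA i hi) u w h hu)
  have y_notin_RS : ∀ t : Finset ι, t ⊆ E → (∀ i ∈ t, i ∉ Cq) → y ∉ RS t := fun t ht hC =>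
    not_mem_setCluster_of_isolated ends hyS fun i hi w hwy h => hC i hi (at_y i (ht hi) w hwy h)
  have y_notin_RU : ∀ t : Finset ι, t ⊆ E → (∀ i ∈ t, i ∉ Cq) → y ∉ RU t := fun t ht hC =>
    not_mem_setCluster_of_isolated ends hyU fun i hi w hwy h => hC i hi (at_y i (ht hi) w hwy h)
  have q_in_RU : ∀ t : Finset ι, (∃ i ∈ Aq, i ∈ t) → q ∈ RU t := by
    rintro t ⟨i, hi, hit⟩
    obtain ⟨u, hu, h⟩ := endsAq i hi
    exact setCluster_step ends U hit h (hUsubRU t (Finset.mem_coe.mpr hu))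
  have y_of_q : ∀ (A : Finset V) (t : Finset ι), q ∈ {v | ∃ a ∈ A, v ∈ openCluster (ends '' (↑t : Set ι)) a} → (∃ k ∈ Cq, k ∈ t) →
      y ∈ {v | ∃ a ∈ A, v ∈ openCluster (ends '' (↑t : Set ι)) a} := by
    rintro A t hq ⟨k, hk, hkt⟩
    exact setCluster_step ends A hkt (endsCq k hk) hq
  -- the pendant facts: `q–y` edges added to a red set
  have pend : ∀ (A : Finset V) (t γ : Finset ι), (↑A : Set V) ⊆ ↑U → t ⊆ E → (∀ i ∈ t, i ∉ Cq) → γ ⊆ Cq →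
      (q ∉ {v | ∃ a ∈ A, v ∈ openCluster (ends '' (↑t : Set ι)) a} →
        {v | ∃ a ∈ A, v ∈ openCluster (ends '' (↑(t ∪ γ) : Set ι)) a} = {v | ∃ a ∈ A, v ∈ openCluster (ends '' (↑t : Set ι)) a}) ∧
      (q ∈ {v | ∃ a ∈ A, v ∈ openCluster (ends '' (↑t : Set ι)) a} → γ ≠ ∅ →
        {v | ∃ a ∈ A, v ∈ openCluster (ends '' (↑(t ∪ γ) : Set ι)) a} = insert y {v | ∃ a ∈ A, v ∈ openCluster (ends '' (↑t : Set ι)) a}) := by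
    intro A t γ hAU ht htC hγ
    have hyA : y ∉ A := fun h => hyU (Finset.mem_coe.mp (hAU (Finset.mem_coe.mpr h)))
    have hyt : y ∉ {v | ∃ a ∈ A, v ∈ openCluster (ends '' (↑t : Set ι)) a} :=
      not_mem_setCluster_of_isolated ends hyA fun i hi w hwy h => htC i hi (at_y i (ht hi) w hwy h)
    constructor
    · intro hq
      refine Set.Subset.antisymm ?_ (setCluster_mono ends A Finset.subset_union_left)
      refine setCluster_subset_of_closed ends (subset_setCluster ends A t) fun i hi u w huw hu => ?_
      rcases Finset.mem_union.mp hi with hit | hiγ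
      · exact setCluster_step ends A hit huw hu
      · exfalso
        have h' := endsCq i (hγ hiγ)
        rw [huw] at h'
        rcases Sym2.eq_iff.mp h' with ⟨huq, _⟩ | ⟨huy, _⟩
        · exact hq (huq ▸ hu)
        · exact hyt (huy ▸ hu)
    · intro hq hγne
      obtain ⟨j, hj⟩ := Finset.nonempty_of_ne_empty hγne
      refine Set.Subset.antisymm ?_ ?_
      · refine setCluster_subset_of_closed ends ((subset_setCluster ends A t).trans (Set.subset_insert _ _)) fun i hi u w huw hu => ?_
        rcases Finset.mem_union.mp hi with hit | hiγ
        · rcases Set.mem_insert_iff.mp hu with huy | hu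
          · -- an edge of `t` at `y`: only a loop (its class would be `Cq`)
            by_cases hwy : w = y
            · exact hwy ▸ Set.mem_insert _ _
            · exact absurd (at_y i (ht hit) w hwy (by rw [huw, huy, Sym2.eq_swap])) (htC i hit)
          · exact Set.mem_insert_of_mem _ (setCluster_step ends A hit huw hu)
        · have h' := endsCq i (hγ hiγ)
          rw [huw] at h'
          rcases Sym2.eq_iff.mp h' with ⟨_, hwy⟩ | ⟨_, hwq⟩
          · exact hwy ▸ Set.mem_insert _ _
          · exact Set.mem_insert_of_mem _ (hwq ▸ hq)
      · refine Set.insert_subset ?_ (setCluster_mono ends A Finset.subset_union_left)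
        exact setCluster_step ends A (Finset.mem_union_right _ hj) (endsCq j (hγ hj)) (setCluster_mono ends A Finset.subset_union_left hq)
  /- ### decomposition `E = E' ∪ Out` and reduction to a fixed inner colouring `τ` -/
  have hdisjE : Disjoint E' Out := Finset.sdiff_disjoint
  have hEE : E' ∪ Out = E := Finset.sdiff_union_of_subset hOutE
  rw [Finset.sum_filter, Finset.sum_filter]
  rw [show (∑ s ∈ E.powerset, if admU s then TU s else 0) =
      ∑ τ ∈ E'.powerset, ∑ ω ∈ Out.powerset, (if admU (τ ∪ ω) then TU (τ ∪ ω) else 0) by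
    rw [← sum_powerset_union_of_disjoint E' Out hdisjE (fun s => if admU s then TU s else 0), hEE]]
  rw [show (∑ s ∈ E.powerset, if admS s then TS s else 0) =
      ∑ τ ∈ E'.powerset, ∑ ω ∈ Out.powerset, (if admS (τ ∪ ω) then TS (τ ∪ ω) else 0) by
    rw [← sum_powerset_union_of_disjoint E' Out hdisjE (fun s => if admS s then TS s else 0), hEE]]
  rw [Finset.mul_sum]
  refine Finset.sum_le_sum fun τ hτ => ?_
  have hτE' : τ ⊆ E' := Finset.mem_powerset.mp hτ
  have hτE : τ ⊆ E := hτE'.trans Finset.sdiff_subset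
  have hτOut : ∀ i ∈ τ, i ∉ Out := fun i hi => (Finset.mem_sdiff.mp (hτE' hi)).2
  have hτAq : ∀ i ∈ τ, i ∉ Aq := fun i hi h => hτOut i hi (hAqOut h)
  have hτCq : ∀ i ∈ τ, i ∉ Cq := fun i hi h => hτOut i hi (hCqOut h)
  rw [Finset.mul_sum, ← sub_nonneg, ← Finset.sum_sub_distrib]
  /- ### the slice at `τ`: the maps `ω ↦ R_S(τ ∪ ω∩Out), R_U(τ ∪ ω∩Out), B_U(τ ∪ ω∩Out)` -/
  have sE : ∀ ω : Finset ι, τ ∪ ω ∩ Out ⊆ E := fun ω => Finset.union_subset hτE (Finset.inter_subset_right.trans hOutE)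
  have blue_iff : ∀ ω : Finset ι, ∀ i ∈ Out, (i ∈ E \ (τ ∪ ω ∩ Out) ↔ i ∉ ω) := by
    intro ω i hi
    rw [Finset.mem_sdiff, Finset.mem_union, Finset.mem_inter]
    constructor
    · rintro ⟨_, h⟩ hiω; exact h (Or.inr ⟨hiω, hi⟩)
    · intro hiω; refine ⟨hOutE hi, ?_⟩
      rintro (h | ⟨h, _⟩)
      · exact hτOut i h hi
      · exact hiω h
  have red_imp : ∀ ω : Finset ι, ∀ i ∈ τ ∪ ω ∩ Out, i ∈ Out → i ∈ ω := by
    intro ω i hi hiO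
    rcases Finset.mem_union.mp hi with h | h
    · exact absurd hiO (hτOut i h)
    · exact (Finset.mem_inter.mp h).1
  -- `q` in the red / blue cluster of `U`
  have hqP : ∀ ω : Finset ι, q ∈ RU (τ ∪ ω ∩ Out) ↔ ∃ i ∈ Aq, i ∈ ω := by
    intro ω
    constructor
    · intro hq
      by_contra hne
      refine hqU (Finset.mem_coe.mp (RU_sub_U _ (sE ω) (fun i hi hiA => ?_) hq))
      exact hne ⟨i, hiA, red_imp ω i hi (hAqOut hiA)⟩
    · rintro ⟨i, hi, hiω⟩
      exact q_in_RU _ ⟨i, hi, Finset.mem_union_right _ (Finset.mem_inter.mpr ⟨hiω, hAqOut hi⟩)⟩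
  have hqB : ∀ ω : Finset ι, q ∈ RU (E \ (τ ∪ ω ∩ Out)) ↔ ∃ i ∈ Aq, i ∉ ω := by
    intro ω
    constructor
    · intro hq
      by_contra hne
      refine hqU (Finset.mem_coe.mp (RU_sub_U _ Finset.sdiff_subset (fun i hi hiA => ?_) hq))
      exact hne ⟨i, hiA, (blue_iff ω i (hAqOut hiA)).mp hi⟩
    · rintro ⟨i, hi, hiω⟩
      exact q_in_RU _ ⟨i, hi, (blue_iff ω i (hAqOut hi)).mpr hiω⟩
  -- `y` in the red / blue cluster of `U`: through `q` and a `q–y` edge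
  have hyP : ∀ ω : Finset ι, y ∈ RU (τ ∪ ω ∩ Out) ↔ (∃ i ∈ Aq, i ∈ ω) ∧ (∃ k ∈ Cq, k ∈ ω) := by
    intro ω
    constructor
    · intro hy
      refine ⟨?_, ?_⟩
      · by_contra hne
        refine hyU (Finset.mem_coe.mp (RU_sub_U _ (sE ω) (fun i hi hiA => ?_) hy))
        exact hne ⟨i, hiA, red_imp ω i hi (hAqOut hiA)⟩
      · by_contra hne
        refine y_notin_RU _ (sE ω) (fun i hi hiC => ?_) hy
        exact hne ⟨i, hiC, red_imp ω i hi (hCqOut hiC)⟩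
    · rintro ⟨hA, ⟨k, hk, hkω⟩⟩
      exact y_of_q U _ ((hqP ω).mpr hA) ⟨k, hk, Finset.mem_union_right _ (Finset.mem_inter.mpr ⟨hkω, hCqOut hk⟩)⟩
  have hyB : ∀ ω : Finset ι, y ∈ RU (E \ (τ ∪ ω ∩ Out)) ↔ (∃ i ∈ Aq, i ∉ ω) ∧ (∃ k ∈ Cq, k ∉ ω) := by
    intro ω
    constructor
    · intro hy
      refine ⟨?_, ?_⟩
      · by_contra hne
        refine hyU (Finset.mem_coe.mp (RU_sub_U _ Finset.sdiff_subset (fun i hi hiA => ?_) hy))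
        exact hne ⟨i, hiA, (blue_iff ω i (hAqOut hiA)).mp hi⟩
      · by_contra hne
        refine y_notin_RU _ Finset.sdiff_subset (fun i hi hiC => ?_) hy
        exact hne ⟨i, hiC, (blue_iff ω i (hCqOut hiC)).mp hi⟩
    · rintro ⟨hA, ⟨k, hk, hkω⟩⟩
      exact y_of_q U _ ((hqB ω).mpr hA) ⟨k, hk, (blue_iff ω k (hCqOut hk)).mpr hkω⟩
  have hyA : ∀ α : Finset ι, α ⊆ Aq → y ∉ RS (τ ∪ α ∩ Out) := by
    intro α hα
    refine y_notin_RS _ (sE α) fun i hi hiC => ?_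
    rcases Finset.mem_union.mp hi with h | h
    · exact hτCq i h hiC
    · exact hAqCq i (hα (Finset.mem_inter.mp h).1) hiC
  have noCq : ∀ α : Finset ι, α ⊆ Aq → ∀ i ∈ τ ∪ α ∩ Out, i ∉ Cq := by
    intro α hα i hi hiC
    rcases Finset.mem_union.mp hi with h | h
    · exact hτCq i h hiC
    · exact hAqCq i (hα (Finset.mem_inter.mp h).1) hiC
  have inter_eq : ∀ α γ : Finset ι, α ⊆ Aq → γ ⊆ Cq → τ ∪ (α ∪ γ) ∩ Out = (τ ∪ α ∩ Out) ∪ γ := by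
    intro α γ hα hγ
    rw [Finset.inter_eq_left.mpr (Finset.union_subset (hα.trans hAqOut) (hγ.trans hCqOut)), Finset.inter_eq_left.mpr (hα.trans hAqOut),
      Finset.union_assoc]
  have hpend0 : ∀ α γ : Finset ι, α ⊆ Aq → γ ⊆ Cq → q ∉ RS (τ ∪ α ∩ Out) → RS (τ ∪ (α ∪ γ) ∩ Out) = RS (τ ∪ α ∩ Out) := by
    intro α γ hα hγ hq
    rw [inter_eq α γ hα hγ]
    exact (pend S _ γ hSU (sE α) (noCq α hα) hγ).1 hq
  have hpend1 : ∀ α γ : Finset ι, α ⊆ Aq → γ ⊆ Cq → q ∈ RS (τ ∪ α ∩ Out) → γ ≠ ∅ → RS (τ ∪ (α ∪ γ) ∩ Out) = insert y (RS (τ ∪ α ∩ Out)) := by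
    intro α γ hα hγ hq hne
    rw [inter_eq α γ hα hγ]
    exact (pend S _ γ hSU (sE α) (noCq α hα) hγ).2 hq hne
  have hR0 : RS (τ ∪ ∅ ∩ Out) ⊆ ↑U := by
    rw [Finset.empty_inter, Finset.union_empty]
    exact RS_sub_U τ hτE hτAq
  have hcore := rcset_row_two_core_noBy Aq Cq hdisj hAqne hCqne U y q hyq hyU hqU memU f g hf hg
    (fun ω => RS (τ ∪ ω ∩ Out)) (fun ω => RU (τ ∪ ω ∩ Out)) (fun ω => RU (E \ (τ ∪ ω ∩ Out)))
    (fun ω => hUsubRU _) (fun ω => hUsubRU _)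
    (fun ω ω' h => setCluster_mono ends S (Finset.union_subset_union subset_rfl (Finset.inter_subset_inter_right h)))
    hR0 hqP hqB hyP hyB hyA hpend0 hpend1
  refine hcore.trans_eq (Finset.sum_congr rfl fun ω hω => ?_)
  have hωO : τ ∪ ω ∩ Out = τ ∪ ω := by rw [Finset.inter_eq_left.mpr (Finset.mem_powerset.mp hω)]
  simp only [hωO]
  congr 2

end Coefficientwise

end Summit.CriticalPhenomena.PercolationContinuityZ3.Theorems
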